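import Mathlib
import Summits.Ventures.HodgeRepro2.T5UnitaryGroupIsometry

/-!
# An isotropic non-degenerate hermitian form in three variables has Gram matrix `antidiag(1, u, 1)`

Blind cell `pub-hodge-repro2`, seat p8 (gen 13), Tier-5 kernel support.  The record's hermitian
space at an inert place is given the basis `e, e₀, f` with Gram matrix `antidiag(1, u, 1)` — «that
the record's `(V_v, h)` HAS such a basis» stayed a reading (annex §105, `T5UnitaryGroupIsometry`).
This file proves the field-level half of it: a NON-DEGENERATE hermitian form `⟨·,·⟩_H` on `E³`
with an ISOTROPIC vector `e ≠ 0` (`⟨e, e⟩_H = 0`) is congruent to `antidiag(1, u, 1)` with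
`u = ⟨e₀, e₀⟩_H` star-fixed and non-zero (`2 ≠ 0` in `E`):

* `sesqForm_smul_left` / `sesqForm_sub_left` / … — the sesquilinearity of `⟨·,·⟩_H`;
* `gram_apply` — `(Pᴴ H P) i j = ⟨P_i, P_j⟩_H` (the Gram matrix of the columns; p3's
  `T5SplitHermitianPlane.conjTranspose_mul_mul_apply` is the `Fin 2` case on its own `gramForm` —
  not re-declared, the general-`ι` `sesqForm` of `T5UnitaryGroupIsometry` is the carrier here);
* `exists_sesqForm_eq_one` — a non-degenerate form pairs `e ≠ 0` with some `w` to `1`;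
* `exists_hyperbolic_pair` — the hyperbolic partner `f = w − (⟨w, w⟩ / 2) e`: `⟨e, f⟩ = 1`,
  `⟨f, f⟩ = 0`;
* `exists_orthogonal_ne_zero` — a non-zero `x` orthogonal to `e` and `f` (a `2 × 3` homogeneous
  system, via `Matrix.exists_mulVec_eq_zero_iff` on a padded singular matrix);
* `exists_congruent_J3` — **`∃ P ∈ GL₃(E), u ∈ Eˣ` with `star u = u` and `Pᴴ H P = antidiag(1, u, 1)`**
  (`P = (e | x | f)`, invertible because its columns are independent — pairing with `e` and `f`);
* `mem_formUnitaryGroup_conj` / `formUnitaryGroupMulEquiv_conj` — **`U(H) ≅ U(Pᴴ H P)`** by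
  conjugation, so the unitary group of the record's form is the `U(antidiag(1, u, 1))` of the
  inert-place package.

What stays a reading: that the record's form is isotropic at the inert places (printed: a
hermitian form in ≥ 3 variables over a non-archimedean local field is isotropic), and the
integrality normalisation `u ∈ 𝒪_F^×` with a SELF-DUAL lattice spanned by `e, e₀, f` (printed:
Jacobowitz's classification).

README §8(d): uses an L-value-free non-vanishing device: NO.
-/

namespace Summit.Ventures.HodgeRepro2.T5HermitianIsotropicForm

open Matrix T5UnitaryGroupIsometry

section Sesquilinear

variable {E : Type*} [CommRing E] [StarRing E] {ι : Type*} [Fintype ι]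

/-- `⟨c • v, w⟩_J = star c * ⟨v, w⟩_J`. -/
theorem sesqForm_smul_left (J : Matrix ι ι E) (c : E) (v w : ι → E) :
    sesqForm J (c • v) w = star c * sesqForm J v w := by
  simp only [sesqForm, dotProduct, Pi.star_apply, Pi.smul_apply, smul_eq_mul, star_mul',
    Finset.mul_sum, mul_assoc]

/-- `⟨v + v', w⟩_J = ⟨v, w⟩_J + ⟨v', w⟩_J`. -/
theorem sesqForm_add_left (J : Matrix ι ι E) (v v' w : ι → E) :
    sesqForm J (v + v') w = sesqForm J v w + sesqForm J v' w := by
  simp only [sesqForm, star_add, add_dotProduct]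

/-- `⟨v - v', w⟩_J = ⟨v, w⟩_J - ⟨v', w⟩_J`. -/
theorem sesqForm_sub_left (J : Matrix ι ι E) (v v' w : ι → E) :
    sesqForm J (v - v') w = sesqForm J v w - sesqForm J v' w := by
  simp only [sesqForm, star_sub, sub_dotProduct]

/-- `⟨v, w - w'⟩_J = ⟨v, w⟩_J - ⟨v, w'⟩_J`. -/
theorem sesqForm_sub_right (J : Matrix ι ι E) (v w w' : ι → E) :
    sesqForm J v (w - w') = sesqForm J v w - sesqForm J v w' := by
  simp only [sesqForm, mulVec_sub, dotProduct_sub]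

/-- `⟨0, w⟩_J = 0`. -/
theorem sesqForm_zero_left (J : Matrix ι ι E) (w : ι → E) : sesqForm J 0 w = 0 := by
  simp only [sesqForm, star_zero, zero_dotProduct]

/-- `⟨v, 0⟩_J = 0`. -/
theorem sesqForm_zero_right (J : Matrix ι ι E) (v : ι → E) : sesqForm J v 0 = 0 := by
  simp only [sesqForm, mulVec_zero, dotProduct_zero]

/-- The Gram matrix of the columns of `P`: `(Pᴴ * H * P) i j = ⟨P.col i, P.col j⟩_H`. -/
theorem gram_apply (H P : Matrix ι ι E) (i j : ι) :
    (Pᴴ * H * P) i j = sesqForm H (P.col i) (P.col j) := by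
  simp only [sesqForm, dotProduct, mulVec, Matrix.mul_apply, conjTranspose_apply, Pi.star_apply,
    col_apply, Finset.sum_mul, Finset.mul_sum, mul_assoc]
  exact Finset.sum_comm

/-- The value `⟨v, v⟩_H` of a hermitian form is star-fixed. -/
theorem star_sesqForm_self {H : Matrix ι ι E} (hH : H.IsHermitian) (v : ι → E) :
    star (sesqForm H v v) = sesqForm H v v :=
  star_sesqForm_of_isHermitian hH v v

end Sesquilinear

section Field

variable {E : Type*} [Field E] [StarRing E]

/-- A non-degenerate form pairs a non-zero vector `e` with some `w` to `1`. -/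
theorem exists_sesqForm_eq_one {H : Matrix (Fin 3) (Fin 3) E} (hu : IsUnit H) {e : Fin 3 → E}
    (he : e ≠ 0) : ∃ w : Fin 3 → E, sesqForm H e w = 1 := by
  have hrow : star e ᵥ* H ≠ 0 := by
    intro h0
    apply he
    have hinj := Matrix.vecMul_injective_iff_isUnit.mpr hu
    have : star e = 0 := hinj (by show star e ᵥ* H = 0 ᵥ* H; rw [h0, zero_vecMul])
    simpa only [star_eq_zero] using this
  obtain ⟨j, hj⟩ := Function.ne_iff.mp hrow
  have hj' : (star e ᵥ* H) j ≠ 0 := by simpa using hj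
  refine ⟨((star e ᵥ* H) j)⁻¹ • Pi.single j 1, ?_⟩
  rw [sesqForm_smul_right, sesqForm, mulVec_single_one]
  have hcol : star e ⬝ᵥ H.col j = (star e ᵥ* H) j := rfl
  rw [hcol]
  exact inv_mul_cancel₀ hj'

/-- The hyperbolic partner of an isotropic vector: from `⟨e, w⟩ = 1` and `⟨e, e⟩ = 0`, the vector
`f = w - (⟨w, w⟩ / 2) • e` satisfies `⟨e, f⟩ = 1` and `⟨f, f⟩ = 0` (`2 ≠ 0`). -/
theorem exists_hyperbolic_pair {H : Matrix (Fin 3) (Fin 3) E} (hH : H.IsHermitian)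
    (h2 : (2 : E) ≠ 0) {e w : Fin 3 → E} (he0 : sesqForm H e e = 0) (hw : sesqForm H e w = 1) :
    ∃ f : Fin 3 → E, sesqForm H e f = 1 ∧ sesqForm H f f = 0 := by
  have hwe : sesqForm H w e = 1 := by
    rw [← star_sesqForm_of_isHermitian hH, hw, star_one]
  have hstar2 : star (2 : E) = 2 := by
    rw [show (2 : E) = 1 + 1 from one_add_one_eq_two.symm, star_add, star_one]
  set a : E := sesqForm H w w / 2 with ha
  have hstara : star a = a := by
    rw [ha, star_div₀, star_sesqForm_self hH, hstar2]
  refine ⟨w - a • e, ?_, ?_⟩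
  · rw [sesqForm_sub_right, sesqForm_smul_right, he0, mul_zero, sub_zero, hw]
  · have hexp : sesqForm H (w - a • e) (w - a • e) =
        sesqForm H w w - a * sesqForm H w e - star a * sesqForm H e w +
          star a * (a * sesqForm H e e) := by
      rw [sesqForm_sub_right, sesqForm_sub_left, sesqForm_sub_left, sesqForm_smul_right,
        sesqForm_smul_right, sesqForm_smul_left, sesqForm_smul_left]
      ring
    rw [hexp, he0, hwe, hw, hstara, ha]
    field_simp
    ring

/-- A non-zero vector orthogonal to `e` and `f`: the homogeneous `2 × 3` system has a non-trivial
solution. -/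
theorem exists_orthogonal_ne_zero (H : Matrix (Fin 3) (Fin 3) E) (e f : Fin 3 → E) :
    ∃ x : Fin 3 → E, x ≠ 0 ∧ sesqForm H e x = 0 ∧ sesqForm H f x = 0 := by
  set M : Matrix (Fin 3) (Fin 3) E := Matrix.of ![star e ᵥ* H, star f ᵥ* H, 0] with hM
  have hdet : M.det = 0 := by
    apply Matrix.det_eq_zero_of_row_eq_zero 2
    intro j
    simp [hM]
  obtain ⟨x, hx, hMx⟩ := Matrix.exists_mulVec_eq_zero_iff.mpr hdet
  refine ⟨x, hx, ?_, ?_⟩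
  · have := congrFun hMx 0
    simpa [hM, mulVec, sesqForm, dotProduct_mulVec] using this
  · have := congrFun hMx 1
    simpa [hM, mulVec, sesqForm, dotProduct_mulVec] using this

omit [StarRing E] in
/-- The determinant of the record's Gram matrix `antidiag(1, u, 1)` is `-u`. -/
theorem det_J3 (u : E) : (T5HermitianThreeElements.J3 u).det = -u := by
  rw [T5HermitianThreeElements.J3_eq, Matrix.det_fin_three]
  simp

/-- **An isotropic non-degenerate hermitian form in three variables is congruent to
`antidiag(1, u, 1)`** with `u` star-fixed and non-zero: for `H` hermitian and invertible, `2 ≠ 0`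
and `e ≠ 0` with `⟨e, e⟩_H = 0`, there are an invertible `P` (whose first column is `e`) and `u`
with `Pᴴ * H * P = J3 u`. -/
theorem exists_congruent_J3 {H : Matrix (Fin 3) (Fin 3) E} (hH : H.IsHermitian) (hu : IsUnit H)
    (h2 : (2 : E) ≠ 0) {e : Fin 3 → E} (he : e ≠ 0) (he0 : sesqForm H e e = 0) :
    ∃ (P : Matrix (Fin 3) (Fin 3) E) (u : E), IsUnit P ∧ star u = u ∧ u ≠ 0 ∧
      P.col 0 = e ∧ Pᴴ * H * P = T5HermitianThreeElements.J3 u := by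
  obtain ⟨w, hw⟩ := exists_sesqForm_eq_one hu he
  obtain ⟨f, hef, hff⟩ := exists_hyperbolic_pair hH h2 he0 hw
  obtain ⟨x, hx, hex, hfx⟩ := exists_orthogonal_ne_zero H e f
  have hfe : sesqForm H f e = 1 := by
    rw [← star_sesqForm_of_isHermitian hH, hef, star_one]
  have hxe : sesqForm H x e = 0 := by
    rw [← star_sesqForm_of_isHermitian hH, hex, star_zero]
  have hxf : sesqForm H x f = 0 := by
    rw [← star_sesqForm_of_isHermitian hH, hfx, star_zero]
  set P : Matrix (Fin 3) (Fin 3) E := Matrix.of fun i j => ![e, x, f] j i with hP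
  have hcol : P.col = ![e, x, f] := by
    funext j i
    rfl
  -- the columns are linearly independent: pair a relation with `e` and with `f`
  have hli : LinearIndependent E P.col := by
    rw [Fintype.linearIndependent_iff]
    intro g hg
    rw [Fin.sum_univ_three] at hg
    change g 0 • e + g 1 • x + g 2 • f = 0 at hg
    have h0 : sesqForm H e (g 0 • e + g 1 • x + g 2 • f) = 0 := by
      rw [hg, sesqForm_zero_right]
    have h1 : sesqForm H f (g 0 • e + g 1 • x + g 2 • f) = 0 := by
      rw [hg, sesqForm_zero_right]
    rw [sesqForm_add_right, sesqForm_add_right, sesqForm_smul_right, sesqForm_smul_right,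
      sesqForm_smul_right, he0, hex, hef] at h0
    rw [sesqForm_add_right, sesqForm_add_right, sesqForm_smul_right, sesqForm_smul_right,
      sesqForm_smul_right, hfe, hfx, hff] at h1
    have hg2 : g 2 = 0 := by simpa using h0
    have hg0 : g 0 = 0 := by simpa using h1
    have hg1 : g 1 = 0 := by
      rw [hg0, hg2, zero_smul, zero_smul, zero_add, add_zero] at hg
      exact (smul_eq_zero.mp hg).resolve_right hx
    intro i
    fin_cases i
    · exact hg0
    · exact hg1
    · exact hg2
  have hPu : IsUnit P := Matrix.linearIndependent_cols_iff_isUnit.mp hli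
  set u : E := sesqForm H x x with hu_def
  have hGram : Pᴴ * H * P = T5HermitianThreeElements.J3 u := by
    ext i j
    rw [gram_apply, hcol, T5HermitianThreeElements.J3_eq]
    fin_cases i <;> fin_cases j <;> simp [he0, hex, hef, hxe, hxf, hfe, hfx, hff, hu_def]
  refine ⟨P, u, hPu, star_sesqForm_self hH x, ?_, by rw [hcol]; rfl, hGram⟩
  -- `u ≠ 0`: the Gram matrix of an invertible `P` is invertible, and `det (J3 u) = -u`
  intro hu0
  have hPH : IsUnit Pᴴ := by
    rw [Matrix.isUnit_iff_isUnit_det, det_conjTranspose]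
    exact ((Matrix.isUnit_iff_isUnit_det P).mp hPu).star
  have hunit : IsUnit (Pᴴ * H * P) := (hPH.mul hu).mul hPu
  rw [hGram, Matrix.isUnit_iff_isUnit_det, det_J3, hu0, neg_zero] at hunit
  exact not_isUnit_zero hunit

end Field

section Conjugation

variable {E : Type*} [CommRing E] [StarRing E] {ι : Type*} [Fintype ι] [DecidableEq ι]

/-- Conjugation moves the unitary group of `H` to that of `Pᴴ H P`: `g ∈ U(Pᴴ H P)` iff
`P g P⁻¹ ∈ U(H)` — through the isometry description of both groups. -/
theorem mem_formUnitaryGroup_conj (H : Matrix ι ι E) (P g : GL ι E) :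
    g ∈ T5UnitaryGroupForm.formUnitaryGroup
        ((P : Matrix ι ι E)ᴴ * H * (P : Matrix ι ι E)) ↔
      P * g * P⁻¹ ∈ T5UnitaryGroupForm.formUnitaryGroup H := by
  rw [mem_formUnitaryGroup_iff_isometry, mem_formUnitaryGroup_iff_isometry]
  simp only [← sesqForm_mulVec, Units.val_mul, ← mulVec_mulVec]
  constructor
  · intro h v w
    have := h (((P⁻¹ : GL ι E) : Matrix ι ι E) *ᵥ v) (((P⁻¹ : GL ι E) : Matrix ι ι E) *ᵥ w)
    simpa only [mulVec_mulVec, Units.mul_inv, one_mulVec] using this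
  · intro h v w
    have := h ((P : Matrix ι ι E) *ᵥ v) ((P : Matrix ι ι E) *ᵥ w)
    simpa only [mulVec_mulVec, Units.inv_mul, one_mulVec, Matrix.mul_assoc] using this

/-- The image of `U(Pᴴ H P)` under conjugation by `P` is `U(H)`. -/
theorem map_conj_formUnitaryGroup (H : Matrix ι ι E) (P : GL ι E) :
    (T5UnitaryGroupForm.formUnitaryGroup ((P : Matrix ι ι E)ᴴ * H * (P : Matrix ι ι E))).map
        (MulAut.conj P).toMonoidHom = T5UnitaryGroupForm.formUnitaryGroup H := by
  ext g
  rw [Subgroup.mem_map_equiv, MulAut.conj_symm_apply, mem_formUnitaryGroup_conj]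
  congr! 2
  group

/-- **`U(Pᴴ H P) ≃* U(H)`** by conjugation with `P`. -/
noncomputable def formUnitaryGroupMulEquiv_conj (H : Matrix ι ι E) (P : GL ι E) :
    T5UnitaryGroupForm.formUnitaryGroup ((P : Matrix ι ι E)ᴴ * H * (P : Matrix ι ι E)) ≃*
      T5UnitaryGroupForm.formUnitaryGroup H :=
  (MulEquiv.subgroupMap (MulAut.conj P) _).trans
    (MulEquiv.subgroupCongr (map_conj_formUnitaryGroup H P))

end Conjugation

section Dictionary

variable {E : Type*} [Field E] [StarRing E]

/-- **The unitary group of an isotropic non-degenerate hermitian form in three variables is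
`U(antidiag(1, u, 1))`** for a star-fixed non-zero `u` (`2 ≠ 0`): the dictionary between the
record's `U(V_v)` and the group of the inert-place package. -/
theorem exists_mulEquiv_formUnitaryGroup_J3 {H : Matrix (Fin 3) (Fin 3) E} (hH : H.IsHermitian)
    (hu : IsUnit H) (h2 : (2 : E) ≠ 0) {e : Fin 3 → E} (he : e ≠ 0)
    (he0 : sesqForm H e e = 0) :
    ∃ u : E, star u = u ∧ u ≠ 0 ∧
      Nonempty (T5UnitaryGroupForm.formUnitaryGroup (T5HermitianThreeElements.J3 u) ≃*
        T5UnitaryGroupForm.formUnitaryGroup H) := by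
  obtain ⟨P, u, hPu, hsu, hu0, -, hGram⟩ := exists_congruent_J3 hH hu h2 he he0
  obtain ⟨Pu, rfl⟩ := hPu
  refine ⟨u, hsu, hu0, ⟨?_⟩⟩
  rw [← hGram]
  exact formUnitaryGroupMulEquiv_conj H Pu

end Dictionary

section Toy

/-- A non-vacuity witness over `ℂ` with complex conjugation: the hermitian form `diag(1, 1, -1)`
(signature `(2,1)`) is non-degenerate and isotropic — `e = (1, 0, 1)`. -/
theorem toy_diag_isHermitian : (Matrix.diagonal ![(1 : ℂ), 1, -1]).IsHermitian := by
  rw [Matrix.isHermitian_diagonal_iff]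
  intro i
  fin_cases i
  · exact IsSelfAdjoint.one ℂ
  · exact IsSelfAdjoint.one ℂ
  · exact (IsSelfAdjoint.one ℂ).neg

/-- The toy form is invertible. -/
theorem toy_diag_isUnit : IsUnit (Matrix.diagonal ![(1 : ℂ), 1, -1]) := by
  rw [Matrix.isUnit_iff_isUnit_det, Matrix.det_diagonal, Fin.prod_univ_three]
  simp

/-- `(1, 0, 1)` is isotropic for `diag(1, 1, -1)`. -/
theorem toy_isotropic :
    sesqForm (Matrix.diagonal ![(1 : ℂ), 1, -1]) ![1, 0, 1] ![1, 0, 1] = 0 := by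
  simp [sesqForm, Matrix.mulVec_diagonal, dotProduct, Fin.sum_univ_three]

/-- **The hypotheses of `exists_congruent_J3` are jointly satisfiable**: `diag(1, 1, -1)` over `ℂ`
is congruent to `antidiag(1, u, 1)` for some real non-zero `u`, and `U(diag(1,1,-1)) = U(2,1)` is
`U(antidiag(1, u, 1))`. -/
theorem toy_exists_congruent_J3 :
    ∃ (P : Matrix (Fin 3) (Fin 3) ℂ) (u : ℂ), IsUnit P ∧ star u = u ∧ u ≠ 0 ∧
      P.col 0 = ![1, 0, 1] ∧
      Pᴴ * Matrix.diagonal ![(1 : ℂ), 1, -1] * P = T5HermitianThreeElements.J3 u :=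
  exists_congruent_J3 toy_diag_isHermitian toy_diag_isUnit two_ne_zero
    (by simp) toy_isotropic

end Toy

end Summit.Ventures.HodgeRepro2.T5HermitianIsotropicForm
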